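import Summits.QuantumFields.YangMills.Theorems.FibreToTorus.Negative.RateLoadBearing
import Summits.QuantumFields.YangMills.Theorems.HypercubicLimit.Negative.AllTimesGapFalse

/-!
# `FibreToTorus` — support lemmas: the two volume floors
# (`S₁` in the conclusion is decoration; `Lmin` in the hypothesis matters only through its dependence on `M`)

Support file for crux `stmt-QuantumFields-16244`
(`Summit.QuantumFields.YangMills.Theses.ContractibleFibre.FibreToTorus`, route `ContractibleFibre`, rank 4),
extracted from the standing disprover's work file `Cruxes/FibreToTorus/Disproof.lean` §3b (cycle 1).  Bodies inline
(no auxiliary `def … : Prop`); tree objects only (`tube_rate_zero` of `Negative/RateLoadBearing.lean`, the a-priori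
bound `HypercubicLimit.Negative.abs_latticeConnectedCorr_le`).

* `torusGap_iff_floorZero` — the CONCLUSION of the crux for `(G, r)` (the `UniformLatticeGap` body) is equivalent to
  the same display with `∃ S₁ … S₁ ≤ S →` deleted: finitely many small tori are absorbed into the constant,
  `C' := max C (2 C_A C_B e^{m S₁})`, by `|corr| ≤ 2 C_A C_B` and `n ≤ S < S₁`.  So `S₁` carries no content (a prover
  of the finite-size stub (V) may produce one freely; a refuter gains nothing from small tori).
* `tube_floor_uniform_iff` — in the HYPOTHESIS, a volume floor chosen BEFORE the width (`∃ Lmin ∀ M`) can be dropped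
  (`Lmin := 0`): short tubes `L < Lmin` have `2n < L ≤ Lmin`, so the a-priori bound `2` (`tube_rate_zero`) is below
  `2e^{m·Lmin}e^{-mn}`.  Hence the ONLY content of `∃ Lmin` in the crux's hypothesis is its position AFTER `∀ M` — the
  route's torelon floor `L_min(β, M, w) ≍ m β (M+1)²` growing with the width: the hypothesis never controls a tube with
  `L ≲ L_min(M)`, and every use of it passes through `L → ∞` at fixed `M` (strategist's census §0(ii), now kernel-checked
  in its quantifier form).

Nothing here asserts a statement of the route (negative/support lane, `--supports stmt-QuantumFields-16244`). [folklore]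
-/

noncomputable section

namespace Summit.QuantumFields.YangMills.Theorems.FibreToTorus.Negative

open MeasureTheory Filter Topology
open Literature.MathematicalPhysics.QuantumFieldTheory

variable {G : Type} [Group G] [TopologicalSpace G] [IsTopologicalGroup G] [CompactSpace G]
  [MeasurableSpace G] [BorelSpace G]

/-- **The torus floor `S₁` is decoration.**  The conclusion of `FibreToTorus` for `(G, r)` (left, verbatim the
`UniformLatticeGap` body) is equivalent to the floor-free display (right). [folklore] -/
theorem torusGap_iff_floorZero (r : LatticeRep G) :
    (∃ β₀ : ℝ, ∀ β : ℝ, β₀ ≤ β → ∃ m : ℝ, 0 < m ∧ ∃ S₁ : ℕ, ∀ A B : YMSpecies G, ∃ C : ℝ, ∀ S n : ℕ, S₁ ≤ S → n ≤ S → |latticeConnectedCorr r.ρ β (2 * S + 1) A.F B.F n| ≤ C * Real.exp (-(m * n))) ↔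
      ∃ β₀ : ℝ, ∀ β : ℝ, β₀ ≤ β → ∃ m : ℝ, 0 < m ∧ ∀ A B : YMSpecies G, ∃ C : ℝ, ∀ S n : ℕ, n ≤ S → |latticeConnectedCorr r.ρ β (2 * S + 1) A.F B.F n| ≤ C * Real.exp (-(m * n)) := by
  constructor
  · rintro ⟨β₀, h⟩
    refine ⟨β₀, fun β hβ => ?_⟩
    obtain ⟨m, hm, S₁, h⟩ := h β hβ
    refine ⟨m, hm, fun A B => ?_⟩
    obtain ⟨C, hC⟩ := h A B
    obtain ⟨CA, hCA⟩ := A.bounded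
    obtain ⟨CB, hCB⟩ := B.bounded
    refine ⟨max C (2 * (CA * CB) * Real.exp (m * S₁)), fun S n hn => ?_⟩
    by_cases hS : S₁ ≤ S
    · exact (hC S n hS hn).trans (mul_le_mul_of_nonneg_right (le_max_left _ _) (Real.exp_pos _).le)
    · push Not at hS
      have hapr := HypercubicLimit.Negative.abs_latticeConnectedCorr_le r β (2 * S + 1) hCA hCB n
      have h0 : 0 ≤ 2 * (CA * CB) := le_trans (abs_nonneg _) hapr
      have hnS : (n : ℝ) ≤ S₁ := by exact_mod_cast (hn.trans hS.le)
      calc |latticeConnectedCorr r.ρ β (2 * S + 1) A.F B.F n| ≤ 2 * (CA * CB) := hapr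
        _ = 2 * (CA * CB) * Real.exp (m * S₁) * Real.exp (-(m * S₁)) := by
            rw [mul_assoc (2 * (CA * CB)), ← Real.exp_add, add_neg_cancel, Real.exp_zero, mul_one]
        _ ≤ 2 * (CA * CB) * Real.exp (m * S₁) * Real.exp (-(m * n)) :=
            mul_le_mul_of_nonneg_left (Real.exp_le_exp.2 (by nlinarith)) (by positivity)
        _ ≤ max C (2 * (CA * CB) * Real.exp (m * S₁)) * Real.exp (-(m * n)) :=
            mul_le_mul_of_nonneg_right (le_max_right _ _) (Real.exp_pos _).le
  · rintro ⟨β₀, h⟩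
    refine ⟨β₀, fun β hβ => ?_⟩
    obtain ⟨m, hm, h⟩ := h β hβ
    refine ⟨m, hm, 0, fun A B => ?_⟩
    obtain ⟨C, hC⟩ := h A B
    exact ⟨C, fun S n _ hn => hC S n hn⟩

/-- Sanity (kernel-checked): the left-hand side above IS the conclusion of the crux, i.e. `FibreToTorus` is by
`Iff.rfl` "tube family ⇒ that display" over the route file's vocabulary. -/
example : Summit.QuantumFields.YangMills.Theses.ContractibleFibre.FibreToTorus ↔
    (∀ (G : Type) [Group G] [TopologicalSpace G] [IsTopologicalGroup G] [CompactSpace G], IsCompactSimpleLieGroup G → letI : MeasurableSpace G := borel G; haveI : BorelSpace G := ⟨rfl⟩; ∀ r : LatticeRep G, let Tube := fun (M : ℕ) (β m C : ℝ) (w Lmin : ℕ) => ∀ (L : ℕ) [NeZero L], Lmin ≤ L → let St := ZMod L × ZMod L × Fin (M + 1) × Fin (M + 1); let Cfg := St × Fin 4 → G; let ν : MeasureTheory.Measure Cfg := MeasureTheory.Measure.pi fun _ => haarProbability G; let sh : St → Fin 4 → St := fun x μ => ![(x.1 + 1, x.2.1, x.2.2.1, x.2.2.2), (x.1, x.2.1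 + 1, x.2.2.1, x.2.2.2), (x.1, x.2.1, x.2.2.1 + 1, x.2.2.2), (x.1, x.2.1, x.2.2.1, x.2.2.2 + 1)] μ; let ins : St → Fin 4 → Fin 4 → ℝ := fun x μ κ => if ((μ = 2 ∨ κ = 2) → (x.2.2.1 : ℕ) < M) ∧ ((μ = 3 ∨ κ = 3) → (x.2.2.2 : ℕ) < M) then 1 else 0; let pl : Cfg → St → Fin 4 → Fin 4 → G := fun U x μ κ => U (x, μ) * U (sh x μ, κ) * (U (sh x κ, μ))⁻¹ * (U (x, κ))⁻¹; let act : Cfg → ℝ := fun U => β * ∑ x : St, ∑ q : {q : Fin 4 × Fin 4 // q.1 < q.2}, ins x q.1.1 q.1.2 * (r.ρ (pl U x q.1.1 q.1.2)).trace.re; let wgt : Cfg → ℝ := fun U => Real.exp (act U); let Ex : (Cfg → ℝ) → ℝ := fun F => (∫ U, F U * wgt U ∂ν) / (∫ U, wgt U ∂ν); let σ : ℕ → Cfg → Cfg := fun n U p => U ((p.1.1 + n, p.1.2), p.2); ∀ c : ZMod L, let Loc := fun F : Cfg → ℝ => Measurable F ∧ (∀ U, |F U| ≤ 1) ∧ ∀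 U U', (∀ p : St × Fin 4, (p.1.1 - c).val ≤ w → U p = U' p) → F U = F U'; ∀ F₁ F₂ : Cfg → ℝ, Loc F₁ → Loc F₂ → ∀ n : ℕ, 2 * n < L → |Ex (fun U => F₁ U * F₂ (σ n U)) - Ex F₁ * Ex (fun U => F₂ (σ n U))| ≤ C * Real.exp (-(m * n)); (∃ β₁ : ℝ, ∀ β : ℝ, β₁ ≤ β → ∃ m : ℝ, 0 < m ∧ ∀ w : ℕ, ∃ C : ℝ, ∀ M : ℕ, ∃ Lmin : ℕ, Tube M β m C w Lmin) → ∃ β₀ : ℝ, ∀ β : ℝ, β₀ ≤ β → ∃ m : ℝ, 0 < m ∧ ∃ S₁ : ℕ, ∀ A B : YMSpecies G, ∃ C : ℝ, ∀ S n : ℕ, S₁ ≤ S → n ≤ S → |latticeConnectedCorr r.ρ β (2 * S + 1) A.F B.F n| ≤ C * Real.exp (-(m * n))) :=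
  Iff.rfl

omit [MeasurableSpace G] [BorelSpace G] in
/-- **The tube floor `Lmin` matters only through `M`.**  For the route file's predicate `Tube` (verbatim), any rate
`m ≥ 0`, coupling `β` and slab width `w`: a floor uniform in the width can be dropped. [folklore] -/
theorem tube_floor_uniform_iff [MeasurableSpace G] [BorelSpace G] (r : LatticeRep G) (β : ℝ) {m : ℝ}
    (hm : 0 ≤ m) (w : ℕ) :
    let Tube := fun (M : ℕ) (β m C : ℝ) (w Lmin : ℕ) => ∀ (L : ℕ) [NeZero L], Lmin ≤ L → let St := ZMod L × ZMod L × Fin (M + 1) × Fin (M + 1); let Cfg := St × Fin 4 → G; let ν : MeasureTheory.Measure Cfg := MeasureTheory.Measure.pi fun _ => haarProbability G; let sh : St → Fin 4 → St := fun x μ => ![(x.1 + 1, x.2.1, x.2.2.1, x.2.2.2), (x.1, x.2.1 + 1, x.2.2.1, x.2.2.2), (x.1, x.2.1, x.2.2.1 + 1, x.2.2.2), (x.1, x.2.1, x.2.2.1, x.2.2.2 + 1)] μ; let ins : St → Fin 4 → Fin 4 → ℝ := fun x μ κ => if ((μ = 2 ∨ κ = 2) → (x.2.2.1 : ℕ)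 < M) ∧ ((μ = 3 ∨ κ = 3) → (x.2.2.2 : ℕ) < M) then 1 else 0; let pl : Cfg → St → Fin 4 → Fin 4 → G := fun U x μ κ => U (x, μ) * U (sh x μ, κ) * (U (sh x κ, μ))⁻¹ * (U (x, κ))⁻¹; let act : Cfg → ℝ := fun U => β * ∑ x : St, ∑ q : {q : Fin 4 × Fin 4 // q.1 < q.2}, ins x q.1.1 q.1.2 * (r.ρ (pl U x q.1.1 q.1.2)).trace.re; let wgt : Cfg → ℝ := fun U => Real.exp (act U); let Ex : (Cfg → ℝ) → ℝ := fun F => (∫ U, F U * wgt U ∂ν) / (∫ U, wgt U ∂ν); let σ : ℕ → Cfg → Cfg := fun n U p => U ((p.1.1 + n, p.1.2), p.2); ∀ c : ZMod L, let Loc := fun F : Cfg → ℝ => Measurable F ∧ (∀ U, |F U| ≤ 1) ∧ ∀ U U', (∀ p : St × Fin 4, (p.1.1 - c).val ≤ w → U p = U' p) → F U = F U'; ∀ F₁ F₂ : Cfg → ℝ, Loc F₁ → Loc F₂ → ∀ n : ℕ, 2 * n < L → |Ex (fun U => F₁ U * F₂ (σ n U)) - Ex F₁ * Ex (fun U =>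 F₂ (σ n U))| ≤ C * Real.exp (-(m * n)); (∃ C : ℝ, ∃ Lmin : ℕ, ∀ M : ℕ, Tube M β m C w Lmin) ↔ ∃ C : ℝ, ∀ M : ℕ, Tube M β m C w 0 := by
  intro Tube
  constructor
  · rintro ⟨C, Lmin, h⟩
    refine ⟨max C (2 * Real.exp (m * Lmin)), fun M => ?_⟩
    have h2 := tube_rate_zero G r M β w
    have hM := h M
    dsimp only [Tube] at hM h2 ⊢
    intro L _ _
    by_cases hL : Lmin ≤ L
    · intro c F₁ F₂ hF₁ hF₂ n hn
      exact (hM L hL c F₁ F₂ hF₁ hF₂ n hn).trans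
        (mul_le_mul_of_nonneg_right (le_max_left _ _) (Real.exp_pos _).le)
    · push Not at hL
      intro c F₁ F₂ hF₁ hF₂ n hn
      have hb := h2 L (Nat.zero_le _) c F₁ F₂ hF₁ hF₂ n hn
      simp only [zero_mul, neg_zero, Real.exp_zero, mul_one] at hb
      have hnL : (n : ℝ) ≤ Lmin := by exact_mod_cast (by omega : n ≤ Lmin)
      calc _ ≤ (2 : ℝ) := hb
        _ = 2 * Real.exp (m * Lmin) * Real.exp (-(m * Lmin)) := by
            rw [mul_assoc, ← Real.exp_add, add_neg_cancel, Real.exp_zero, mul_one]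
        _ ≤ 2 * Real.exp (m * Lmin) * Real.exp (-(m * n)) :=
            mul_le_mul_of_nonneg_left (Real.exp_le_exp.2 (by nlinarith)) (by positivity)
        _ ≤ max C (2 * Real.exp (m * Lmin)) * Real.exp (-(m * n)) :=
            mul_le_mul_of_nonneg_right (le_max_right _ _) (Real.exp_pos _).le
  · rintro ⟨C, h⟩
    exact ⟨C, 0, h⟩

end Summit.QuantumFields.YangMills.Theorems.FibreToTorus.Negative

end
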